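import Summits.KontsevichZagierPeriods.KontsevichZagierPeriods.Theorems.SoloBlindBetaOdd
import Summits.KontsevichZagierPeriods.KontsevichZagierPeriods.Theorems.SoloBlindPiDisc
import Summits.KontsevichZagierPeriods.KontsevichZagierPeriods.Theorems.SoloBlindPiGraphs
import Summits.KontsevichZagierPeriods.KontsevichZagierPeriods.Theorems.SoloBlindZetaFour
import HarnessLib

/-!
# The `π`-family: one decided family of representations, all dimensions (capstone of s3–s6)

`PiFamily` is the explicit, inductively generated family of rational Kontsevich–Zagier
representations (of all dimensions) that the programme has PLACED in the `π`-sector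
`M_π = K₀[x_π] ⊆ Q` by explicit chains of the three moves:

* the even zeta boxes `B_k = [(0,1)ᵏ, dx/(1 − x₁⋯x_k)]`, every even `k ≥ 2` (`SoloBlindZetaEven`);
* the odd `β`-boxes `Bβ_k = [(0,1)ᵏ, dx/(1 + (x₁⋯x_k)²)]`, every odd `k ≥ 3` (`SoloBlindBetaOdd`);
* the tangent cells `[T_n, w]` (every `n`), the minimum cells `[M_n, w]`, the fence cells
  `[F_n, w]`, the weighted order simplices `[Δ_k, w]` (every `k`) — the cells of the two chains;
* the classical two- and four-dimensional representations of s3–s5: `zetaTwoRep`,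
  `unitSquareRep`, the disc, the Cauchy line, the arcsine and half-ellipse subgraphs, `B₄`,
  `B_{2,2}`, the alternating and even boxes of dimension `4`, the tangent piece;
* and all finite products of these (Fubini, rule (3)).

**Theorem (`kz_piFamily`).**  The Kontsevich–Zagier period conjecture holds on `PiFamily`: two
members with the same period are connected by finitely many applications of the three rules;
and (`kz_piFamily_iff`) on the family, KZ-equivalence is exactly equality of periods.  The single
transcendence input is Lindemann's theorem (through `kz_piSector`, s3); everything else is moves.
-/

noncomputable section

open Literature.NumberTheory.Transcendental Literature.NumberTheory.Transcendental.KZ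
open Literature.ModelTheory.ExponentialFields

namespace Summit.KontsevichZagierPeriods.KontsevichZagierPeriods.Theorems

namespace SoloBlind

/-! ## Memberships for the cells of the chains -/

/-- If `N•[z] = c•(2a(1))ᵏ` in `Q` with `N ≠ 0` then `z ∈ M_π`. -/
theorem mem_piSector_of_nsmul_eq_nsmul_pow {z : FormalRep} {N c k : ℕ} (hN : N ≠ 0)
    (h : N • mkQ z = c • ((2 : K₀) • alpha 1) ^ k) : z ∈ piSector := by
  have hy : (2 : K₀) • alpha 1 = (2⁻¹ : K₀) • xPi := by
    rw [xPi, smul_smul]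
    norm_num
  have hz : mkQ z = (N : K₀)⁻¹ • (c • ((2⁻¹ : K₀) • xPi) ^ k) := by
    rw [← hy, ← h, ← Nat.cast_smul_eq_nsmul K₀ N, inv_smul_smul₀ (Nat.cast_ne_zero.mpr hN)]
  rw [mem_piSector, hz, smul_pow]
  exact Subalgebra.smul_mem _ (Subalgebra.nsmul_mem _ (Subalgebra.smul_mem _
    (Subalgebra.pow_mem _ (Algebra.self_mem_adjoin_singleton K₀ xPi) _) _) _) _

/-- `[Δ_k, w] ∈ M_π` (every `k`). -/
theorem of_simplexPieceK_mem_piSector (k : ℕ) : of (simplexPieceK k) ∈ piSector :=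
  mem_piSector_of_nsmul_eq_nsmul_pow (c := 1) (Nat.factorial_ne_zero k)
    (by rw [one_nsmul, factorial_nsmul_simplexPieceK])

/-- `[T_n, w] ∈ M_π` (every `n`, both parities). -/
theorem of_cycPiece_mem_piSector (n : ℕ) : of (cycPiece n) ∈ piSector :=
  mem_piSector_of_nsmul_eq_nsmul_pow
    (Nat.mul_ne_zero two_ne_zero (Nat.factorial_ne_zero _)) (nsmul_mkQ_cycPiece_fence n)

/-- `[F_n, w] ∈ M_π` (every `n`). -/
theorem of_fencePiece_mem_piSector (n : ℕ) : of (fencePiece n) ∈ piSector := by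
  have h : ((n + 2).factorial * 2) • mkQ (of (fencePiece n)) =
      fenceCount n • ((2 : K₀) • alpha 1) ^ (n + 2) := by
    rw [mul_nsmul, smul_comm, two_nsmul_mkQ_fencePiece, smul_comm,
      factorial_nsmul_simplexPieceK]
  exact mem_piSector_of_nsmul_eq_nsmul_pow
    (Nat.mul_ne_zero (Nat.factorial_ne_zero _) two_ne_zero) h

/-- `[M_n, w] ∈ M_π` (every `n`). -/
theorem of_minPiece_mem_piSector (n : ℕ) : of (minPiece n) ∈ piSector := by
  have h := of_fencePiece_mem_piSector n
  rw [mem_piSector] at h ⊢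
  rwa [mkQ_eq_mkQ_iff.mpr (minPiece_equiv_fencePiece n)]

/-! ## The family -/

/-- **The `π`-family** of rational KZ representations (all dimensions), generated by the
representations placed in `M_π` in s3–s6 and closed under products. -/
inductive PiFamily : ∀ {n : ℕ}, IntegralRep n → Prop
  /-- even zeta boxes `B_k`, `k ≥ 2` even -/
  | boxZeta {k : ℕ} (hk : 2 ≤ k) (he : Even k) : PiFamily (boxZetaRep k hk)
  /-- odd `β`-boxes `Bβ_k`, `k ≥ 3` odd -/
  | betaBox {k : ℕ} (hk : 2 ≤ k) (ho : Odd k) : PiFamily (betaBoxRep k)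
  /-- tangent cells `[T_n, w]` -/
  | cyc (n : ℕ) : PiFamily (cycPiece n)
  /-- minimum cells `[M_n, w]` -/
  | min (n : ℕ) : PiFamily (minPiece n)
  /-- fence cells `[F_n, w]` -/
  | fence (n : ℕ) : PiFamily (fencePiece n)
  /-- weighted order simplices `[Δ_k, w]` -/
  | simplex (k : ℕ) : PiFamily (simplexPieceK k)
  /-- `Z = [(0,1)², 1/(1−xy)]` -/
  | zetaTwo : PiFamily zetaTwoRep
  /-- `S = [(0,1)², 1/((1+x²)(1+y²))]`-type unit square representation -/
  | unitSquare : PiFamily unitSquareRep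
  /-- the unit disc -/
  | disc : PiFamily discRep
  /-- the Cauchy line `[ℝ… (0,∞)-type, 1/(1+x²)]` -/
  | cauchy : PiFamily cauchyLine
  /-- the arcsine subgraph -/
  | arcsine : PiFamily arcsineRep
  /-- the half ellipse -/
  | halfEllipse : PiFamily halfEllipseRep
  /-- `B₄` -/
  | boxFour : PiFamily boxFour
  /-- the MZV box `B_{2,2}` -/
  | boxTwoTwo : PiFamily boxTwoTwo
  /-- the alternating box of dimension `4` -/
  | alt : PiFamily altRep
  /-- the even box of dimension `4` -/
  | even : PiFamily evenRep
  /-- the tangent piece of dimension `4` -/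
  | tan : PiFamily tanPiece
  /-- products (Fubini) -/
  | prod {n m : ℕ} {r : IntegralRep n} {s : IntegralRep m} :
      PiFamily r → PiFamily s → PiFamily (r.prod s)

/-- Every member of the `π`-family lies in the `π`-sector `M_π = K₀[x_π]`. -/
theorem PiFamily.mem_piSector {n : ℕ} {r : IntegralRep n} (h : PiFamily r) : of r ∈ piSector := by
  induction h with
  | boxZeta hk he => exact of_boxZetaRep_mem_piSector_even hk he
  | betaBox hk ho => exact of_betaBoxRep_mem_piSector_odd hk ho
  | cyc n => exact of_cycPiece_mem_piSector n
  | min n => exact of_minPiece_mem_piSector n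
  | fence n => exact of_fencePiece_mem_piSector n
  | simplex k => exact of_simplexPieceK_mem_piSector k
  | zetaTwo => exact of_zetaTwoRep_mem_piSector
  | unitSquare => exact of_unitSquareRep_mem_piSector
  | disc => exact of_discRep_mem_piSector
  | cauchy => exact of_cauchyLine_mem_piSector
  | arcsine => exact of_arcsineRep_mem_piSector
  | halfEllipse => exact of_halfEllipseRep_mem_piSector
  | boxFour => exact of_boxFour_mem_piSector
  | boxTwoTwo => exact of_boxTwoTwo_mem_piSector
  | alt => exact of_altRep_mem_piSector
  | even => exact of_evenRep_mem_piSector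
  | tan => exact of_tanPiece_mem_piSector
  | prod _ _ ih₁ ih₂ =>
    rw [← of_mul_of]
    exact piSector.mul_mem ih₁ ih₂

/-- **The Kontsevich–Zagier period conjecture holds on the `π`-family**: two members (of any
dimensions) with the same period are connected by the three rules. -/
theorem kz_piFamily {n m : ℕ} {r : IntegralRep n} {r' : IntegralRep m} (hr : PiFamily r)
    (hr' : PiFamily r') (hv : r.value = r'.value) : Equivalent r r' :=
  kz_piSector r r' hr.mem_piSector hr'.mem_piSector hv

/-- On the `π`-family KZ-equivalence IS equality of periods. -/
theorem kz_piFamily_iff {n m : ℕ} {r : IntegralRep n} {r' : IntegralRep m} (hr : PiFamily r)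
    (hr' : PiFamily r') : Equivalent r r' ↔ r.value = r'.value :=
  ⟨fun h => Equivalent.value_eq_holds h, kz_piFamily hr hr'⟩

/-- Example: `B₂ × Bβ₃ × [T₅, w]` against `B₄ × B₆` — decided (by their periods). -/
example (hv : ((boxZetaRep 2 le_rfl).prod ((betaBoxRep 3).prod (cycPiece 5))).value =
    ((boxZetaRep 4 (by norm_num)).prod (boxZetaRep 6 (by norm_num))).value) :
    Equivalent ((boxZetaRep 2 le_rfl).prod ((betaBoxRep 3).prod (cycPiece 5)))
      ((boxZetaRep 4 (by norm_num)).prod (boxZetaRep 6 (by norm_num))) :=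
  kz_piFamily (.prod (.boxZeta le_rfl even_two) (.prod (.betaBox (by norm_num) (by decide))
    (.cyc 5))) (.prod (.boxZeta _ (by decide)) (.boxZeta _ (by decide))) hv

end SoloBlind

end Summit.KontsevichZagierPeriods.KontsevichZagierPeriods.Theorems
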